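import Literature.Probability.LatticeModels.BoxSplitTwoBlockGap
import Literature.Probability.LatticeModels.GlauberOverlapAveraging
import HarnessLib

/-!
# Spectral gap of a box from the gaps of its overlapping halves ([Mar99] Theorem 4.5, (4.14)–(4.16)), PROVED

Topic `Literature/Probability/LatticeModels`; cell `ym-ir`, seat lit-3 (census rows B2/B4).  Theorems only
(D-0026).  The scale-doubling STEP of [Mar99] Theorem 4.5 (p0188 L36 – p0189 L27), for a box `Q = Π[a_i,b_i)`
and the `N` two-block coverings `Top_n = {y_j ≥ c + nδ}`, `Bot_n = {y_j < c + nδ + δ}` (`n < N`) with pairwise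
disjoint overlap strips of width `δ`: if `SMT(·, l, m)` holds on all boxes with sides in `[ρ+1−r, 2ρ+1]`
(`ρ + r ≤ δ`), every half `Top_n, Bot_n` has gap `≥ g` uniformly in the boundary condition, and the explicit
smallness `κ̄ < ½` holds, then `gap(L_Q^τ) ≥ (1 − √(κ̄/(1−κ̄))) · g · N/(N+1)` — (4.16) with
`1 − C₁/√L ↝ (1 − √ε)·N/(N+1)`.  Assembled from `Glauber.boxSplit_blockPoincare` ((3.33) + Prop 3.5) and
`Glauber.poincareIneq_of_twoBlock_family` ((4.14)–(4.16)).  What remains for the typed fact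
`Glauber.Martinelli1999_thm4_5` is bookkeeping: the choice `δ = ⌊√L⌋`, `N ≈ L/(10δ)`, `ρ = δ − r`, fatness of the
halves (cases a)/b) p0189 L29–34), the iteration (4.17)–(4.19), and the infinite product for `inf_L g(L) > 0`.
SIBLING-SETTING result (`±1` spins, range `r`); the Yang–Mills gap is not touched.
[cite: Martinelli1999, Theorem 4.5, proof, (4.14)–(4.16)]
-/

open MeasureTheory ProbabilityTheory Finset Filter

noncomputable section

namespace Literature.Probability.LatticeModels

namespace Glauber

variable {d : ℕ}

/-- `κ ↦ κ/(1−κ)` is monotone on `[0,1)` (bookkeeping of the two-block error; a public copy exists as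
`KreinString.div_one_sub_mono` in an unrelated corner of the tree). [folklore] -/
private theorem div_one_sub_le_div_one_sub {x y : ℝ} (hxy : x ≤ y) (hy : y < 1) :
    x / (1 - x) ≤ y / (1 - y) := by
  rw [div_le_div_iff₀ (by linarith) (by linarith)]
  nlinarith

section Step

variable {r : ℕ} (U : FRPotential d ℤˣ r) (β : ℝ)

set_option maxHeartbeats 1600000 in
/-- **[Mar99] Theorem 4.5, the scale step (4.14)–(4.16) for a box**: see the module docstring.
[cite: Martinelli1999, Theorem 4.5, proof, (4.16)] -/
theorem poincareIneq_box_of_halves {R : ℝ} (hR1 : 1 ≤ R)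
    (hR : ∀ (Λ : Finset (Site d)) (y : Site d) (σ : Site d → ℤˣ),
      R⁻¹ ≤ flipWeight U β Λ y σ ∧ flipWeight U β Λ y σ ≤ R)
    {a b : Site d} {j : Fin d} {c : ℤ} {δ N : ℕ} (hN : 0 < N) (hδ0 : 0 < δ) (hc : a j ≤ c)
    (hend : c + N * δ + δ ≤ b j)
    {ρ : ℕ} (hρr : r ≤ ρ) (hρδ : ρ + r ≤ δ) (hwide : ∀ i, i ≠ j → (ρ : ℤ) + 1 ≤ b i - a i)
    {l m : ℝ} (hm : 0 ≤ m) (hl : l ≤ (ρ : ℝ) - 2 * r)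
    (hSMT : ∀ a' b' : Site d, (∀ i, (ρ : ℤ) + 1 - r ≤ b' i - a' i ∧ b' i - a' i ≤ 2 * ρ + 1) →
      SMT (U.spec β) (Fintype.piFinset fun i => Finset.Ico ((a') i) ((b') i)) l m)
    {κ : ℝ} (hκdef : κ = (1 + R ^ 6 * (2 * r + 1 : ℝ) ^ d * (2 * r + 1 : ℝ) ^ d * ((Fintype.piFinset fun i => Finset.Ico ((a) i) ((b) i))).card *
        ((2 * (ρ + r) + 1) ^ d : ℕ) * Real.exp (-(m * ((ρ : ℝ) - 2 * r)))) ^ ((Fintype.piFinset fun i => Finset.Ico ((a) i) ((b) i))).card - 1)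
    (hκ : κ < 1 / 2) {g : ℝ} (hg : 0 ≤ g)
    (hTop : ∀ n : ℕ, n < N → ∀ φ : Site d → ℤˣ,
      PoincareIneq (U.spec β (Fintype.piFinset fun i => Finset.Ico ((Function.update a j (c + n * δ)) i) ((b) i)) φ) (Fintype.piFinset fun i => Finset.Ico ((Function.update a j (c + n * δ)) i) ((b) i)) g)
    (hBot : ∀ n : ℕ, n < N → ∀ φ : Site d → ℤˣ,
      PoincareIneq (U.spec β (Fintype.piFinset fun i => Finset.Ico ((a) i) ((Function.update b j (c + n * δ + δ)) i)) φ)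
        (Fintype.piFinset fun i => Finset.Ico ((a) i) ((Function.update b j (c + n * δ + δ)) i)) g)
    (τ : Site d → ℤˣ) :
    PoincareIneq (U.spec β (Fintype.piFinset fun i => Finset.Ico ((a) i) ((b) i)) τ) (Fintype.piFinset fun i => Finset.Ico ((a) i) ((b) i)) ((1 - Real.sqrt (κ / (1 - κ))) * g * N / (N + 1)) := by
  classical
  have hγ := U.isSpecification_spec β
  set Q := (Fintype.piFinset fun i => Finset.Ico ((a) i) ((b) i)) with hQ
  -- the family
  set sN : Fin N → ℤ := fun n => c + (n : ℕ) * δ with hsN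
  set A : Fin N → Finset (Site d) := fun n => (Fintype.piFinset fun i => Finset.Ico ((Function.update a j (sN n)) i) ((b) i)) with hA
  set B : Fin N → Finset (Site d) := fun n => (Fintype.piFinset fun i => Finset.Ico ((a) i) ((Function.update b j (sN n + δ)) i)) with hB
  have hs_le : ∀ n : Fin N, a j ≤ sN n := fun n => by
    simp only [hsN]; have : (0 : ℤ) ≤ (n : ℕ) * δ := by positivity
    linarith
  have hst : ∀ n : Fin N, sN n < sN n + δ := fun n => by
    have : (0 : ℤ) < δ := by exact_mod_cast hδ0
    linarith
  have ht_le : ∀ n : Fin N, sN n + δ ≤ b j := fun n => by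
    simp only [hsN]
    have h1 : ((n : ℕ) : ℤ) * δ + δ ≤ N * δ := by
      have h2 : ((n : ℕ) : ℤ) + 1 ≤ N := by exact_mod_cast n.2
      have h3 : (0 : ℤ) ≤ δ := by positivity
      nlinarith
    have h4 : (0 : ℤ) ≤ δ := by positivity
    linarith
  have hAV : ∀ n, A n ⊆ Q := fun n => IcoBox_top_subset a b j _ (hs_le n)
  have hBV : ∀ n, B n ⊆ Q := fun n => IcoBox_bot_subset a b j _ (ht_le n)
  -- disjoint overlaps
  have hdisj : ∀ n n', n ≠ n' → Disjoint (A n ∩ B n) (A n' ∩ B n') := by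
    intro n n' hne
    rw [show A n ∩ B n = _ from IcoBox_top_inter_bot a b j _ _ (hs_le n) (ht_le n),
      show A n' ∩ B n' = _ from IcoBox_top_inter_bot a b j _ _ (hs_le n') (ht_le n')]
    rw [Finset.disjoint_left]
    intro y hy hy'
    have h1 := mem_IcoBox.1 hy j
    have h2 := mem_IcoBox.1 hy' j
    simp only [Function.update_self] at h1 h2
    have hδ0' : (0 : ℤ) ≤ δ := by positivity
    rcases Nat.lt_or_gt_of_ne (fun h => hne (Fin.ext h)) with hlt | hlt
    · have h3 : ((n : ℕ) : ℤ) + 1 ≤ (n' : ℕ) := by exact_mod_cast hlt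
      have h4 : sN n + δ ≤ sN n' := by simp only [hsN]; nlinarith
      linarith [h1.2, h2.1]
    · have h3 : ((n' : ℕ) : ℤ) + 1 ≤ (n : ℕ) := by exact_mod_cast hlt
      have h4 : sN n' + δ ≤ sN n := by simp only [hsN]; nlinarith
      linarith [h1.1, h2.2]
  -- the two-block gaps
  have hρst : ∀ n : Fin N, (ρ : ℤ) + r ≤ sN n + δ - sN n := fun n => by
    have : ((ρ + r : ℕ) : ℤ) ≤ δ := by exact_mod_cast hρδ
    push_cast at this; linarith
  set ε := κ / (1 - κ) with hε
  have hκ0 : 0 ≤ κ := by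
    rw [hκdef, sub_nonneg]
    exact one_le_pow₀ (le_add_of_nonneg_right (by positivity))
  have hD : ∀ n, BlockPoincareIneq (U.spec β) ![A n, B n] Q τ (1 - Real.sqrt ε) := by
    intro n
    -- the explicit error of the `n`-th split is at most `κ`
    set κn := (1 + R ^ 6 * (2 * r + 1 : ℝ) ^ d * (2 * r + 1 : ℝ) ^ d *
        ((rOuterBoundary r (A n ∩ B n)).filter (· ∈ A n)).card *
        ((2 * (ρ + r) + 1) ^ d : ℕ) * Real.exp (-(m * ((ρ : ℝ) - 2 * r)))) ^
        ((rOuterBoundary r (A n)).filter (· ∈ B n)).card - 1 with hκn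
    have hc1 : (((rOuterBoundary r (A n ∩ B n)).filter (· ∈ A n)).card : ℝ) ≤ Q.card := by
      exact_mod_cast Finset.card_le_card fun z hz => hAV n (Finset.mem_filter.1 hz).2
    have hc2 : ((rOuterBoundary r (A n)).filter (· ∈ B n)).card ≤ Q.card :=
      Finset.card_le_card fun z hz => hBV n (Finset.mem_filter.1 hz).2
    have hκnκ : κn ≤ κ := by
      rw [hκn, hκdef]
      refine sub_le_sub_right ?_ 1
      set α : ℝ := R ^ 6 * (2 * r + 1 : ℝ) ^ d * (2 * r + 1 : ℝ) ^ d with hα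
      set e : ℝ := ((2 * (ρ + r) + 1) ^ d : ℕ) * Real.exp (-(m * ((ρ : ℝ) - 2 * r))) with he
      have hα0 : 0 ≤ α := by positivity
      have he0 : 0 ≤ e := by positivity
      have h1 : (1 : ℝ) + α * ((rOuterBoundary r (A n ∩ B n)).filter (· ∈ A n)).card *
          ((2 * (ρ + r) + 1) ^ d : ℕ) * Real.exp (-(m * ((ρ : ℝ) - 2 * r))) ≤
          1 + α * Q.card * ((2 * (ρ + r) + 1) ^ d : ℕ) * Real.exp (-(m * ((ρ : ℝ) - 2 * r))) := by
        have : α * (((rOuterBoundary r (A n ∩ B n)).filter (· ∈ A n)).card : ℝ) * e ≤ α * Q.card * e := by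
          gcongr
        rw [he] at this; nlinarith [this]
      have hb1 : (1 : ℝ) ≤ 1 + α * ((rOuterBoundary r (A n ∩ B n)).filter (· ∈ A n)).card *
          ((2 * (ρ + r) + 1) ^ d : ℕ) * Real.exp (-(m * ((ρ : ℝ) - 2 * r))) :=
        le_add_of_nonneg_right (by positivity)
      calc (1 + α * ((rOuterBoundary r (A n ∩ B n)).filter (· ∈ A n)).card *
            ((2 * (ρ + r) + 1) ^ d : ℕ) * Real.exp (-(m * ((ρ : ℝ) - 2 * r)))) ^
            ((rOuterBoundary r (A n)).filter (· ∈ B n)).card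
          ≤ (1 + α * Q.card * ((2 * (ρ + r) + 1) ^ d : ℕ) * Real.exp (-(m * ((ρ : ℝ) - 2 * r)))) ^
            ((rOuterBoundary r (A n)).filter (· ∈ B n)).card := pow_le_pow_left₀ (by linarith) h1 _
        _ ≤ (1 + α * Q.card * ((2 * (ρ + r) + 1) ^ d : ℕ) * Real.exp (-(m * ((ρ : ℝ) - 2 * r)))) ^ Q.card :=
            pow_le_pow_right₀ (le_add_of_nonneg_right (by positivity)) hc2
    have hκn2 : κn < 1 / 2 := lt_of_le_of_lt hκnκ hκ
    have h := boxSplit_blockPoincare U β hR1 hR (hs_le n) (hst n) (ht_le n) hρr (hρst n) hwide hm hl hSMT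
      hκn hκn2 τ
    refine h.mono (sub_le_sub_left (Real.sqrt_le_sqrt ?_) 1)
    exact div_one_sub_le_div_one_sub hκnκ (by linarith)
  have hAin : ∀ n (φ : Site d → ℤˣ), PoincareIneq (U.spec β (A n) φ) (A n) g := fun n φ =>
    hTop n n.2 φ
  have hBin : ∀ n (φ : Site d → ℤˣ), PoincareIneq (U.spec β (B n) φ) (B n) g := fun n φ =>
    hBot n n.2 φ
  have key := poincareIneq_of_twoBlock_family hγ τ hN A B hAV hBV hdisj hg hD hAin hBin
  have e : (1 - Real.sqrt ε) * g * N / (N + 1) = (1 - Real.sqrt (κ / (1 - κ))) * g * N / (N + 1) := by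
    rw [hε]
  rw [← e]
  exact key

end Step

end Glauber

end Literature.Probability.LatticeModels

end
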